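import Summits.QuantumFields.YangMills.Theorems.FluctuationComparisonRegPrIntLS2BetaDiscRowDockHalf
import Summits.QuantumFields.YangMills.Theorems.FluctuationComparisonRegPrIntLS2BetaSourceBudgetOfColumns
import Summits.QuantumFields.YangMills.Theorems.FluctuationComparisonRegPrIntLS2BetaKappaRatioDeltaColumn
import Summits.QuantumFields.YangMills.Theorems.FluctuationComparisonRegPrIntLS2BetaPartnerStagePlaqSmall
import HarnessLib

/-!
# S2β · THE SUP CHAIN — hDBX⁗'s DATUM BODY FROM THE COLUMN LETTERS: `∃ X, (SPLIT at q := 0) ∧ (SRC′ with closed-form C_X, β_X)`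
# from {κ-pack: `hρT` pointwise + `hP` budget of the c₁ CELL-MASS letter ρP; ρ̃-pack: `hρ` pointwise + `hρt` budget; `hArc` at ¼; the two `histGood` memberships}

Cell `ym3-torus` (rung R3 = continuum `SU(2)` Yang–Mills on the three-torus at fixed lattice data — NOT d = 4, NOT infinite volume, NOT a mass gap, NOT Clay).
Width seat «width 20» `ym3-torus-px20` (gen 24), FREE px helper on crux `stmt-QuantumFields-20520`, LINE g18-1 S2β; ARCHITECT px17 g22 2026-08-31 22:45:29Z «GO (η)»
(«the natural capstone one level below LEAD's knit v4⁗»).  `--kind proof --supports stmt-QuantumFields-20520 --as helper`, count-neutral, DEFINITION-FREE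
(0 `def`, 0 `instance`, 0 `notation`, 0 `sorry`); ONE decl-local `set_option maxHeartbeats 400000 in` (README HEARTBEAT-BUDGET form: the two name-applications
`hDisc_of_discRow …`∕`hX'_of_rColumn … (hR_of_columns …)` unify ≈ 10⁴-token station texts — measured: fails at 200k, passes at 300k and 400k, wall ≈ 35 s).

WHAT IS PROVED (sorry-free).  ★★★`discBudget_datum_of_columns` — for ONE datum (the `∀ F … U₀ = (g₀⁻¹g₀′)•U₁ →` body of LEAD's `hDBX` binder in ⧗`supTowerLetter4_of_arc_discSplit`),
the conclusion **`∃ X : ℕ → ℝ, (∀ t < K−J, D′lam t ≤ X t + 0·E′lam t) ∧ (Σ_t L^t·X t ≤ C_X·e^{cΣθ′}·purse + β_X·S′)`** with `D′lam`, `E′lam`, purse, `S′` the station's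
texts VERBATIM and **`C_X := 4(π∕2)²·(2(3K_c)²·Cκ + c₁²·Cρ)`, `β_X := 4(π∕2)²·(2(3K_c)²·βκ + 2(3K_c·2(ℓ+2)·α)²·C_adj + c₁²·βρ) + 2·(π·6·(K₅·α)·(h+1)·(11∕10·L⁻¹))²·L`**
(`K_c = ((d+2)L)²∕4`, `ℓ = (d+2)L`, `C_adj = 2d·7^d`, `c₁ = (2((L−1)∕2))·(2+2((L−1)∕2))`, `K₅ = (5L)²∕4`, `h = (L−1)∕2`; κ′ := 1, q := 0), FROM: the `AxStage`∕station binders of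
✓p835795 `discRow'` (arc profile at the flat `¼` = ✓p835602 N's letter), the prefix facts `0 ≤ θ`, `((5L)²∕4)·θ_i ≤ α` (`J < i ≤ K`), `α ≤ 1∕24`, the two `histGood` memberships, and
FOUR COLUMN LETTERS — κ-pack: `ρP : ℕ → PBond (F.P J) 0 → ℝ` with the POINTWISE letter `hρT` (relative plaquettes of `(Ū^sU₀, Ū^s(e^ζU₀))` over the three blocks of every
`READ′_t(B)` bond — ✓p835991 `hκrel_of_textLetters`'s binder VERBATIM; c₁'s CELL-MASS object, RULING «ρκ-CURL») and the BUDGET `hP` (✓∕⧗ px16 δ `hρκ_of_columns`'s binder VERBATIM: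
`Σ_t L^t·Σ_B ρP² ≤ Cκ·e^{cΣθ′}·purse + βκ·S′` = (k1), px10 g26's CELL-MASS tower); ρ̃-pack: `ρt` with the POINTWISE letter `hρ` (✓`discRow'`'s binder VERBATIM — px12 ✓p836058
`rhoTilde_of_regionLetters` inhabits it at `ρt := ρS + ρA + 2(4sU+aU)mA + 2(4sA+aA)mA`) and the BUDGET `hρt` (px21 (α) `hR_of_columns`'s binder VERBATIM).  INSIDE, by name:
`a := a′ := fun t => θ (J+(t+1))` with `hplaq`∕`hplaqP` ⟸ w4 g28 (k3) `hplaq_of_histGood`∕`hplaqP_of_histGood`, `hthr`∕`hthrN` ⟸ `2α ≤ 1∕12 < 1∕3 = δ_SU(2)`, `a t ≤ α` ⟸ `(5L)²∕4 ≥ 1`;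
`δC` := px16 δ's boxed Pi-sup with `hδT` ⟸ δ §1 `hδT_of_boxSup`; `ρκ := 3·(K_c·(ρP + 2a′(ℓ+2)δC))` with `hκrel` ⟸ ✓p835991 `hκrel_of_textLetters` and its column budget ⟸ δ §3
`hρκ_of_columns`; then ✓p836297 `hDisc_of_discRow` (SPLIT) and ✓p836297 `hX'_of_rColumn` ∘ px21 (α) `hR_of_columns` (SRC′).  So LEAD's hDBX⁗ ⟸ this lemma per datum + the
window arithmetic (`∃ α₀ q β_X C_X c_X` = the closed forms above at `α := α₀`, side goal `6·β_X(α₀) ≤ ¼` ⟸ `βκ`, `βρ` small + `α₀` small).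

HONEST SCOPE.  Real bookkeeping and name-plumbing over landed∕signed lemmas; the four column letters, the arc profile, the `AxStage` clauses, (BKG), (ST‴)∕LOC‴, `h3` are
HYPOTHESES or other seats'; the window arithmetic is NOT here; nothing of Bałaban's renormalisation-group analysis is asserted or proved ([Balaban1985Averaging] Prop. 4
(128)–(135) pp.37–38, [Balaban1985RegularSpaces] (1.19) p.79, (1.29) p.81, [Balaban1987RG1] (0.3)–(0.4) pp.252–253, (0.11) p.253 are the printed objects transcribed); GAP♯∘
(`stub_uniformFibreGapOrbit`, registry 3732b7df UNTOUCHED), the five registered stubs (0∕5), S2β, 20520, 19936, 19200, `YM3TorusSU2` NOT proved; no registered stub is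
closed; rung R3 — NOT d = 4, NOT infinite volume, NOT a mass gap, NOT Clay; the Yang–Mills mass gap is NOT proved.
-/

set_option autoImplicit false

namespace Summit.QuantumFields.YangMills.Theorems.FluctuationComparisonRegPrIntLS2BetaDiscBudgetOfColumns

open scoped Real
open Literature.MathematicalPhysics.QuantumLattice (su2Quat)
open Literature.MathematicalPhysics.QuantumFieldTheory.Balaban1983to89
open T4Continuum T3ContinuumYM3Torus T3TiltDescent T3LevelShift BlockAveraging AveragingRT B10Eq47AxialChi
open B10Eq27TorusAxialLog (rel axialT transl)
open T4CubeChartGnomonic (SU2)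
open T4HaarSU2ExpChart (expPoint)
open T4ExpWindowSmallField (logVec)
open ExpMeanLog (deltaSU)
open T3UnitLawDensityEML (ℰp)
open T3UnitScaleTilt (histGood)
open Summit.QuantumFields.YangMills.Theorems.FluctuationComparisonRegPrIntLS2BetaDiscRowDockHalf (hDisc_of_discRow hX'_of_rColumn)
open Summit.QuantumFields.YangMills.Theorems.FluctuationComparisonRegPrIntLS2BetaSourceBudgetOfColumns (hR_of_columns)
open Summit.QuantumFields.YangMills.Theorems.FluctuationComparisonRegPrIntLS2BetaKappaRatioDeltaColumn (hδT_of_boxSup hρκ_of_columns)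
open Summit.QuantumFields.YangMills.Theorems.FluctuationComparisonRegPrIntLS2BetaKappaRatioTower (hκrel_of_textLetters)
open Summit.QuantumFields.YangMills.Theorems.FluctuationComparisonRegPrIntLS2BetaPartnerStagePlaqSmall (hplaq_of_histGood hplaqP_of_histGood)

variable {F : T3Family}

set_option maxHeartbeats 400000 in
/-- ★★★ **hDBX⁗'s DATUM BODY FROM THE COLUMN LETTERS** (module docstring): `∃ X, (SPLIT at q := 0) ∧ (SRC′)` with closed-form `C_X`, `β_X` in
`(α, L, Cκ, βκ, Cρ, βρ)`, from the κ-pack (`hρT`, `hP`), the ρ̃-pack (`hρ`, `hρt`), the arc profile at `¼`, the prefix facts and the two `histGood` memberships.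
[cite: Balaban1985Averaging, Prop. 4 (128)-(135) p.37-38; Balaban1985RegularSpaces, (1.19) p.79, (1.29) p.81; Balaban1987RG1, (0.3)-(0.4) p.252-253, (0.11) p.253] -/
theorem discBudget_datum_of_columns
    {J K : ℕ} (hJK : J ≤ K) (U₀ : GaugeField (F.P K) 0 (Matrix.specialUnitaryGroup (Fin 2) ℂ)) (ζ : PBond (F.P K) 0 → EuclideanSpace ℝ (Fin 3))
    (wt : (j : ℕ) → PBond (F.P K) j → PBond (F.P K) (j + 1) → ℝ)
    (lift : (j : ℕ) → GaugeField (F.P K) (j + 1) SU2 → GaugeField (F.P K) j SU2)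
    (U₁ : GaugeField (F.P K) 0 SU2) (g g₀ : (j : ℕ) → Site (F.P K) j → SU2)
    (hwt : ∀ j b e, wt j b e = if e.dir = b.dir ∧ (b.src b.dir - emb e.src b.dir).val < (F.P K).L then
        ∏ ν ∈ Finset.univ.erase b.dir, max 0 (1 - ((rel (emb e.src) b.src ν).natAbs : ℝ) / (F.P K).L) else 0)
    (hlift : ∀ j X b, lift j X b = expPoint (∑ e, wt j b e • ((((F.P K).L : ℕ) : ℝ)⁻¹ • logVec (su2Quat (X e)))))
    (hT3 : ∀ X : GaugeField (F.P K) 0 SU2, ∀ j, j ≤ K - J →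
      Averaging.iter (fun k => blockAvg (P := F.P K) (j := k) ℰp) j (GaugeField.gaugeAct (g 0) X) =
        GaugeField.gaugeAct (g j) (Averaging.iter (fun k => blockAvg (P := F.P K) (j := k) ℰp) j X))
    (hT4 : ∀ j, j < K - J → ∀ x,
      axialT (GaugeField.gaugeAct (g j) (Averaging.iter (fun k => blockAvg (P := F.P K) (j := k) ℰp) j (fun ℓ => expPoint (ζ ℓ) * U₀ ℓ))) (emb (blockOf x)) x =
        axialT (lift j (GaugeField.gaugeAct (g (j + 1)) (Averaging.iter (fun k => blockAvg (P := F.P K) (j := k) ℰp) (j + 1) (fun ℓ => expPoint (ζ ℓ) * U₀ ℓ))))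
          (emb (blockOf x)) x)
    (hT3' : ∀ X : GaugeField (F.P K) 0 SU2, ∀ j, j ≤ K - J →
      Averaging.iter (fun k => blockAvg (P := F.P K) (j := k) ℰp) j (GaugeField.gaugeAct (g₀ 0) X) =
        GaugeField.gaugeAct (g₀ j) (Averaging.iter (fun k => blockAvg (P := F.P K) (j := k) ℰp) j X))
    (hT4' : ∀ j, j < K - J → ∀ x,
      axialT (GaugeField.gaugeAct (g₀ j) (Averaging.iter (fun k => blockAvg (P := F.P K) (j := k) ℰp) j U₁)) (emb (blockOf x)) x =
        axialT (lift j (GaugeField.gaugeAct (g₀ (j + 1)) (Averaging.iter (fun k => blockAvg (P := F.P K) (j := k) ℰp) (j + 1) U₁)))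
          (emb (blockOf x)) x)
    (hU₀ : U₀ = GaugeField.gaugeAct (fun x => (g 0 x)⁻¹ * g₀ 0 x) U₁)
    (hArc : ∀ i, 1 ≤ i → i < K - J → ∀ e : PBond (F.P K) i,
      ‖logVec (su2Quat (GaugeField.gaugeAct (g i) (Averaging.iter (fun k => blockAvg (P := F.P K) (j := k) ℰp) i (fun ℓ => expPoint (ζ ℓ) * U₀ ℓ)) e))‖ ≤ 1 / 4 ∧
      ‖logVec (su2Quat (GaugeField.gaugeAct (g₀ i) (Averaging.iter (fun k => blockAvg (P := F.P K) (j := k) ℰp) i U₁) e))‖ ≤ 1 / 4)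
    (hg1 : ∀ j, K - J ≤ j → ∀ y, g j y = 1) (hg1' : ∀ j, K - J ≤ j → ∀ y, g₀ j y = 1)
    (hT6 : ∀ X : GaugeField (F.P K) 0 SU2, Averaging.iter (fun k => blockAvg (P := F.P K) (j := k) ℰp) (K - J) (GaugeField.gaugeAct (fun x => (g 0 x)⁻¹) X) = Averaging.iter (fun k => blockAvg (P := F.P K) (j := k) ℰp) (K - J) X)
    (hT5r : ∀ X : GaugeField (F.P K) 0 SU2, Averaging.iter (fun k => blockAvg (P := F.P K) (j := k) ℰp) (K - J) (GaugeField.gaugeAct (g₀ 0) X) = Averaging.iter (fun k => blockAvg (P := F.P K) (j := k) ℰp) (K - J) X)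
    (hmate : descendTo F ℰp J K hJK (fun ℓ => expPoint (ζ ℓ) * U₀ ℓ : GaugeField (F.P K) 0 (Matrix.specialUnitaryGroup (Fin 2) ℂ)) = descendTo F ℰp J K hJK U₀)
    (θ : ℕ → ℝ) (hθ0 : ∀ i, 0 ≤ θ i) {α : ℝ} (hθα : ∀ i, J < i → i ≤ K → (((5 * F.L : ℕ) : ℝ) ^ 2 / 4) * θ i ≤ α) (hα24 : α ≤ 1 / 24)
    (hU₀g : U₀ ∈ histGood F ℰp θ K J)
    (hζg : (fun ℓ => expPoint (ζ ℓ) * U₀ ℓ : GaugeField (F.P K) 0 (Matrix.specialUnitaryGroup (Fin 2) ℂ)) ∈ histGood F ℰp θ K J)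
    (ρP : ℕ → PBond (F.P J) 0 → ℝ) (hρP0 : ∀ t B, 0 ≤ ρP t B)
    (hρT : ∀ (t : ℕ) (ht : t < K - J) (B : PBond (F.P J) 0) (q : Plaq (F.P K) (K - (J + (t + 1)))),
      (∃ ℓ' : PBond (F.P (J + (t + 1))) 0, (∃ z : Site (F.P (J + (t + 1))) 0,
                (B14.Eq22Determines.blockIter (t + 1) z = (bondShift (F.sitesPerDir_eq (m := F.m) (K := J) (j := 0) (m' := F.m) (K' := J + (t + 1)) (j' := t + 1) (by omega)) B).src ∨ B14.Eq22Determines.blockIter (t + 1) z = (bondShift (F.sitesPerDir_eq (m := F.m) (K := J) (j := 0) (m' := F.m) (K' := J + (t + 1)) (j' := t + 1) (by omega)) B).tgt) ∧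
                ∀ ν, (B10Eq27TorusAxialLog.rel z ℓ'.src ν).natAbs ≤ 2) ∧
        (blockOf q.src = (blockOf (bondShift (F.sitesPerDir_eq (m := F.m) (K := J + (t + 1)) (j := 0) (m' := F.m) (K' := K) (j' := (K - (J + (t + 1)))) (by omega)) ℓ').src).unshift (bondShift (F.sitesPerDir_eq (m := F.m) (K := J + (t + 1)) (j := 0) (m' := F.m) (K' := K) (j' := (K - (J + (t + 1)))) (by omega)) ℓ').dir ∨
          blockOf q.src = blockOf (bondShift (F.sitesPerDir_eq (m := F.m) (K := J + (t + 1)) (j := 0) (m' := F.m) (K' := K) (j' := (K - (J + (t + 1)))) (by omega)) ℓ').src ∨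
          blockOf q.src = (blockOf (bondShift (F.sitesPerDir_eq (m := F.m) (K := J + (t + 1)) (j := 0) (m' := F.m) (K' := K) (j' := (K - (J + (t + 1)))) (by omega)) ℓ').src).shift (bondShift (F.sitesPerDir_eq (m := F.m) (K := J + (t + 1)) (j := 0) (m' := F.m) (K' := K) (j' := (K - (J + (t + 1)))) (by omega)) ℓ').dir)) →
      dist1 ((GaugeField.plaqHol (Averaging.iter (fun k => blockAvg (P := F.P K) (j := k) ℰp) (K - (J + (t + 1))) U₀) q)⁻¹ *
        GaugeField.plaqHol (Averaging.iter (fun k => blockAvg (P := F.P K) (j := k) ℰp) (K - (J + (t + 1))) (fun ℓ => expPoint (ζ ℓ) * U₀ ℓ)) q) ≤ ρP t B)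
    {Cκ βκ c : ℝ}
    (hP : ∑ t ∈ Finset.range (K - J), (F.L : ℝ) ^ t * ∑ B : PBond (F.P J) 0, ρP t B ^ 2 ≤
      Cκ * Real.exp (c * ∑ i ∈ Finset.range (K - J), (((5 * F.L : ℕ) : ℝ) ^ 2 / 4) * θ (K - i)) * (((F.L : ℝ)⁻¹) ^ (K - J) * ∑ ℓ : PBond (F.P K) 0, ‖ζ ℓ‖ ^ 2 +
                (F.L : ℝ) ^ (K - J) * ∑ p : Plaq (F.P K) 0,
                  (1 - reTr ((GaugeField.plaqHol U₀ p)⁻¹ * GaugeField.plaqHol (fun ℓ => expPoint (ζ ℓ) * U₀ ℓ : GaugeField (F.P K) 0 (Matrix.specialUnitaryGroup (Fin 2) ℂ)) p))) + βκ * (∑ t ∈ Finset.range (K - J), (if ht : t < K - J then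
          (F.L : ℝ) ^ t * ∑ B : PBond (F.P J) 0,
            ‖(fun ℓ' : PBond (F.P (J + (t + 1))) 0 =>
              if ∃ z : Site (F.P (J + (t + 1))) 0,
                (B14.Eq22Determines.blockIter (t + 1) z = (bondShift (F.sitesPerDir_eq (m := F.m) (K := J) (j := 0) (m' := F.m) (K' := J + (t + 1)) (j' := t + 1) (by omega)) B).src ∨ B14.Eq22Determines.blockIter (t + 1) z = (bondShift (F.sitesPerDir_eq (m := F.m) (K := J) (j := 0) (m' := F.m) (K' := J + (t + 1)) (j' := t + 1) (by omega)) B).tgt) ∧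
                ∀ ν, (B10Eq27TorusAxialLog.rel z ℓ'.src ν).natAbs ≤ 2
              then logVec (su2Quat (descendTo F ℰp (J + (t + 1)) K (by omega) (fun ℓ => expPoint (ζ ℓ) * U₀ ℓ : GaugeField (F.P K) 0 (Matrix.specialUnitaryGroup (Fin 2) ℂ)) ℓ' * (descendTo F ℰp (J + (t + 1)) K (by omega) U₀ ℓ')⁻¹)) else 0)‖ ^ 2
        else 0)))
    (ρt : ℕ → PBond (F.P J) 0 → ℝ) (hρt0 : ∀ t B, 0 ≤ ρt t B)
    (hρ : ∀ (t : ℕ) (ht : t < K - J) (B : PBond (F.P J) 0) (q : Plaq (F.P K) (K - (J + (t + 1)))),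
      (∃ ℓ' : PBond (F.P (J + (t + 1))) 0, (∃ z : Site (F.P (J + (t + 1))) 0,
                (B14.Eq22Determines.blockIter (t + 1) z = (bondShift (F.sitesPerDir_eq (m := F.m) (K := J) (j := 0) (m' := F.m) (K' := J + (t + 1)) (j' := t + 1) (by omega)) B).src ∨ B14.Eq22Determines.blockIter (t + 1) z = (bondShift (F.sitesPerDir_eq (m := F.m) (K := J) (j := 0) (m' := F.m) (K' := J + (t + 1)) (j' := t + 1) (by omega)) B).tgt) ∧
                ∀ ν, (B10Eq27TorusAxialLog.rel z ℓ'.src ν).natAbs ≤ 2) ∧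
        (blockOf q.src = blockOf (bondShift (F.sitesPerDir_eq (m := F.m) (K := J + (t + 1)) (j := 0) (m' := F.m) (K' := K) (j' := (K - (J + (t + 1)))) (by omega)) ℓ').src ∨ blockOf q.src = (blockOf (bondShift (F.sitesPerDir_eq (m := F.m) (K := J + (t + 1)) (j := 0) (m' := F.m) (K' := K) (j' := (K - (J + (t + 1)))) (by omega)) ℓ').src).shift (bondShift (F.sitesPerDir_eq (m := F.m) (K := J + (t + 1)) (j := 0) (m' := F.m) (K' := K) (j' := (K - (J + (t + 1)))) (by omega)) ℓ').dir)) →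
      dist1 ((GaugeField.plaqHol (fun b => lift (K - (J + (t + 1))) (GaugeField.gaugeAct (g ((K - (J + (t + 1))) + 1)) (Averaging.iter (fun k => blockAvg (P := F.P K) (j := k) ℰp) ((K - (J + (t + 1))) + 1) (fun ℓ => expPoint (ζ ℓ) * U₀ ℓ))) b *
            (lift (K - (J + (t + 1))) (GaugeField.gaugeAct (g₀ ((K - (J + (t + 1))) + 1)) (Averaging.iter (fun k => blockAvg (P := F.P K) (j := k) ℰp) ((K - (J + (t + 1))) + 1) U₁)) b)⁻¹ *
          (GaugeField.gaugeAct (g₀ (K - (J + (t + 1)))) (Averaging.iter (fun k => blockAvg (P := F.P K) (j := k) ℰp) (K - (J + (t + 1))) U₁)) b : GaugeField (F.P K) (K - (J + (t + 1))) SU2) q)⁻¹ *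
        GaugeField.plaqHol (GaugeField.gaugeAct (g (K - (J + (t + 1)))) (Averaging.iter (fun k => blockAvg (P := F.P K) (j := k) ℰp) (K - (J + (t + 1))) (fun ℓ => expPoint (ζ ℓ) * U₀ ℓ))) q) ≤ ρt t B)
    {Cρ βρ : ℝ}
    (hρt : ∑ t ∈ Finset.range (K - J), (F.L : ℝ) ^ t * ∑ B : PBond (F.P J) 0, ρt t B ^ 2 ≤ Cρ * Real.exp (c * ∑ i ∈ Finset.range (K - J), (((5 * F.L : ℕ) : ℝ) ^ 2 / 4) * θ (K - i)) * (((F.L : ℝ)⁻¹) ^ (K - J) * ∑ ℓ : PBond (F.P K) 0, ‖ζ ℓ‖ ^ 2 +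
                (F.L : ℝ) ^ (K - J) * ∑ p : Plaq (F.P K) 0,
                  (1 - reTr ((GaugeField.plaqHol U₀ p)⁻¹ * GaugeField.plaqHol (fun ℓ => expPoint (ζ ℓ) * U₀ ℓ : GaugeField (F.P K) 0 (Matrix.specialUnitaryGroup (Fin 2) ℂ)) p))) +
      βρ * (∑ t ∈ Finset.range (K - J), (if ht : t < K - J then
          (F.L : ℝ) ^ t * ∑ B : PBond (F.P J) 0,
            ‖(fun ℓ' : PBond (F.P (J + (t + 1))) 0 =>
              if ∃ z : Site (F.P (J + (t + 1))) 0,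
                (B14.Eq22Determines.blockIter (t + 1) z = (bondShift (F.sitesPerDir_eq (m := F.m) (K := J) (j := 0) (m' := F.m) (K' := J + (t + 1)) (j' := t + 1) (by omega)) B).src ∨ B14.Eq22Determines.blockIter (t + 1) z = (bondShift (F.sitesPerDir_eq (m := F.m) (K := J) (j := 0) (m' := F.m) (K' := J + (t + 1)) (j' := t + 1) (by omega)) B).tgt) ∧
                ∀ ν, (B10Eq27TorusAxialLog.rel z ℓ'.src ν).natAbs ≤ 2
              then logVec (su2Quat (descendTo F ℰp (J + (t + 1)) K (by omega) (fun ℓ => expPoint (ζ ℓ) * U₀ ℓ : GaugeField (F.P K) 0 (Matrix.specialUnitaryGroup (Fin 2) ℂ)) ℓ' * (descendTo F ℰp (J + (t + 1)) K (by omega) U₀ ℓ')⁻¹)) else 0)‖ ^ 2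
        else 0))) :
    ∃ X : ℕ → ℝ,
      (∀ (t : ℕ) (ht : t < K - J), (fun (t : ℕ) (ht : t < K - J) => ∑ B : PBond (F.P J) 0,
            ‖(fun ℓ' : PBond (F.P (J + (t + 1))) 0 =>
              if (∃ z : Site (F.P (J + (t + 1))) 0,
                (B14.Eq22Determines.blockIter (t + 1) z = (bondShift (F.sitesPerDir_eq (m := F.m) (K := J) (j := 0) (m' := F.m) (K' := J + (t + 1)) (j' := t + 1) (by omega)) B).src ∨ B14.Eq22Determines.blockIter (t + 1) z = (bondShift (F.sitesPerDir_eq (m := F.m) (K := J) (j := 0) (m' := F.m) (K' := J + (t + 1)) (j' := t + 1) (by omega)) B).tgt) ∧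
                ∀ ν, (B10Eq27TorusAxialLog.rel z ℓ'.src ν).natAbs ≤ 2) ∧
                ¬ (blockOf (ℓ'.src.shift ℓ'.dir) = blockOf ℓ'.src ∧ ∀ ν, ν < ℓ'.dir → B10Eq27TorusAxialLog.rel (emb (blockOf ℓ'.src)) ℓ'.src ν = 0)
              then logVec (su2Quat ((lift (K - (J + (t + 1))) (GaugeField.gaugeAct (g (K - (J + (t + 1)) + 1)) (Averaging.iter (fun k => blockAvg (P := F.P K) (j := k) ℰp) (K - (J + (t + 1)) + 1) (fun ℓ => expPoint (ζ ℓ) * U₀ ℓ))) (bondShift (F.sitesPerDir_eq (m := F.m) (K := J + (t + 1)) (j := 0) (m' := F.m) (K' := K) (j' := (K - (J + (t + 1)))) (by omega)) ℓ') *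
                    (lift (K - (J + (t + 1))) (GaugeField.gaugeAct (g₀ (K - (J + (t + 1)) + 1)) (Averaging.iter (fun k => blockAvg (P := F.P K) (j := k) ℰp) (K - (J + (t + 1)) + 1) U₁)) (bondShift (F.sitesPerDir_eq (m := F.m) (K := J + (t + 1)) (j := 0) (m' := F.m) (K' := K) (j' := (K - (J + (t + 1)))) (by omega)) ℓ'))⁻¹)⁻¹ *
                  (GaugeField.gaugeAct (g (K - (J + (t + 1)))) (Averaging.iter (fun k => blockAvg (P := F.P K) (j := k) ℰp) (K - (J + (t + 1))) (fun ℓ => expPoint (ζ ℓ) * U₀ ℓ)) (bondShift (F.sitesPerDir_eq (m := F.m) (K := J + (t + 1)) (j := 0) (m' := F.m) (K' := K) (j' := (K - (J + (t + 1)))) (by omega)) ℓ') *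
                    (GaugeField.gaugeAct (g₀ (K - (J + (t + 1)))) (Averaging.iter (fun k => blockAvg (P := F.P K) (j := k) ℰp) (K - (J + (t + 1))) U₁) (bondShift (F.sitesPerDir_eq (m := F.m) (K := J + (t + 1)) (j := 0) (m' := F.m) (K' := K) (j' := (K - (J + (t + 1)))) (by omega)) ℓ'))⁻¹))) else 0)‖ ^ 2) t ht ≤ X t + 0 * (fun (t : ℕ) (ht : t < K - J) => ∑ B : PBond (F.P J) 0,
            ‖(fun ℓ' : PBond (F.P (J + (t + 1))) 0 =>
              if ∃ z : Site (F.P (J + (t + 1))) 0,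
                (B14.Eq22Determines.blockIter (t + 1) z = (bondShift (F.sitesPerDir_eq (m := F.m) (K := J) (j := 0) (m' := F.m) (K' := J + (t + 1)) (j' := t + 1) (by omega)) B).src ∨ B14.Eq22Determines.blockIter (t + 1) z = (bondShift (F.sitesPerDir_eq (m := F.m) (K := J) (j := 0) (m' := F.m) (K' := J + (t + 1)) (j' := t + 1) (by omega)) B).tgt) ∧
                ∀ ν, (B10Eq27TorusAxialLog.rel z ℓ'.src ν).natAbs ≤ 2
              then logVec (su2Quat (descendTo F ℰp (J + (t + 1)) K (by omega) (fun ℓ => expPoint (ζ ℓ) * U₀ ℓ : GaugeField (F.P K) 0 (Matrix.specialUnitaryGroup (Fin 2) ℂ)) ℓ' * (descendTo F ℰp (J + (t + 1)) K (by omega) U₀ ℓ')⁻¹)) else 0)‖ ^ 2) t ht) ∧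
      ∑ t ∈ Finset.range (K - J), (F.L : ℝ) ^ t * X t ≤
        (2 * (1 + 1) * (π / 2) ^ 2) * (2 * (3 * ((((5 * F.L : ℕ) : ℝ)) ^ 2 / 4)) ^ 2 * Cκ + ((((2 * ((F.L - 1) / 2) : ℕ) : ℝ)) * (2 + 2 * (((F.L - 1) / 2 : ℕ) : ℝ))) ^ 2 * Cρ) * Real.exp (c * ∑ i ∈ Finset.range (K - J), (((5 * F.L : ℕ) : ℝ) ^ 2 / 4) * θ (K - i)) * (((F.L : ℝ)⁻¹) ^ (K - J) * ∑ ℓ : PBond (F.P K) 0, ‖ζ ℓ‖ ^ 2 +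
                (F.L : ℝ) ^ (K - J) * ∑ p : Plaq (F.P K) 0,
                  (1 - reTr ((GaugeField.plaqHol U₀ p)⁻¹ * GaugeField.plaqHol (fun ℓ => expPoint (ζ ℓ) * U₀ ℓ : GaugeField (F.P K) 0 (Matrix.specialUnitaryGroup (Fin 2) ℂ)) p))) +
        ((2 * (1 + 1) * (π / 2) ^ 2) * ((2 * (3 * ((((5 * F.L : ℕ) : ℝ)) ^ 2 / 4)) ^ 2 * βκ + 2 * (3 * ((((5 * F.L : ℕ) : ℝ)) ^ 2 / 4) * (2 * (((5 * F.L : ℕ) : ℝ) + 2) * α)) ^ 2 * ((2 * 3 * 7 ^ 3 : ℕ) : ℝ)) + ((((2 * ((F.L - 1) / 2) : ℕ) : ℝ)) * (2 + 2 * (((F.L - 1) / 2 : ℕ) : ℝ))) ^ 2 * βρ) +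
        (1 + 1⁻¹) * (π * ((6 * (((((5 * F.L : ℕ) : ℝ)) ^ 2 / 4) * α)) * ((((F.L - 1) / 2 + 1 : ℕ) : ℝ) * (11 / 10 * (F.L : ℝ)⁻¹)))) ^ 2 * (F.L : ℝ)) * (∑ t ∈ Finset.range (K - J), (if ht : t < K - J then
          (F.L : ℝ) ^ t * ∑ B : PBond (F.P J) 0,
            ‖(fun ℓ' : PBond (F.P (J + (t + 1))) 0 =>
              if ∃ z : Site (F.P (J + (t + 1))) 0,
                (B14.Eq22Determines.blockIter (t + 1) z = (bondShift (F.sitesPerDir_eq (m := F.m) (K := J) (j := 0) (m' := F.m) (K' := J + (t + 1)) (j' := t + 1) (by omega)) B).src ∨ B14.Eq22Determines.blockIter (t + 1) z = (bondShift (F.sitesPerDir_eq (m := F.m) (K := J) (j := 0) (m' := F.m) (K' := J + (t + 1)) (j' := t + 1) (by omega)) B).tgt) ∧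
                ∀ ν, (B10Eq27TorusAxialLog.rel z ℓ'.src ν).natAbs ≤ 2
              then logVec (su2Quat (descendTo F ℰp (J + (t + 1)) K (by omega) (fun ℓ => expPoint (ζ ℓ) * U₀ ℓ : GaugeField (F.P K) 0 (Matrix.specialUnitaryGroup (Fin 2) ℂ)) ℓ' * (descendTo F ℰp (J + (t + 1)) K (by omega) U₀ ℓ')⁻¹)) else 0)‖ ^ 2
        else 0)) := by
  have _h := hJK
  -- derived prefix facts
  have hL2 : 2 ≤ F.L := by obtain ⟨⟨k, hk⟩, h1⟩ := F.hL; omega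
  have hδ : deltaSU (Fin 2) = 1 / 3 := by
    unfold deltaSU
    rw [Fintype.card_fin]
    exact min_eq_left (by have := Real.pi_gt_three; push_cast; linarith)
  have ha0 : ∀ t, 0 ≤ (fun (t : ℕ) => θ (J + (t + 1))) t := fun t => hθ0 _
  have hKθ : ∀ t, t < K - J → ((((5 * F.L : ℕ) : ℝ)) ^ 2 / 4) * (fun (t : ℕ) => θ (J + (t + 1))) t ≤ α := fun t ht => hθα (J + (t + 1)) (by omega) (by omega)
  have h25 : (1 : ℝ) ≤ (((5 * F.L : ℕ) : ℝ)) ^ 2 / 4 := by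
    have h5 : (5 : ℝ) ≤ ((5 * F.L : ℕ) : ℝ) := by exact_mod_cast (show 5 ≤ 5 * F.L by omega)
    nlinarith
  have haα : ∀ t, t < K - J → (fun (t : ℕ) => θ (J + (t + 1))) t ≤ α := fun t ht => by nlinarith [hKθ t ht, ha0 t, h25]
  have hthr : ∀ t, t < K - J → ((((5 * F.L : ℕ) : ℝ)) ^ 2 / 4) * (fun (t : ℕ) => θ (J + (t + 1))) t < deltaSU (Fin 2) := fun t ht => by
    rw [hδ]; linarith [hKθ t ht]
  have eK : (((((F.P K).d + 2) * (F.P K).L : ℕ) : ℝ) ^ 2 / 4) = ((((5 * F.L : ℕ) : ℝ)) ^ 2 / 4) := rfl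
  have hthrN : ∀ t, t < K - J → (((((F.P K).d + 2) * (F.P K).L : ℕ) : ℝ) ^ 2 / 4) * ((fun (t : ℕ) => θ (J + (t + 1))) t + (fun (t : ℕ) => θ (J + (t + 1))) t) < deltaSU (Fin 2) := fun t ht => by
    rw [eK, hδ]; linarith [hKθ t ht]
  -- the stage plaquette classes from the two `histGood` memberships ((k3))
  have hplaq : ∀ t, t < K - J → PlaqSmall ((fun (t : ℕ) => θ (J + (t + 1))) t) (Averaging.iter (fun k => blockAvg (P := F.P K) (j := k) ℰp) (K - (J + (t + 1))) U₀) :=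
    hplaq_of_histGood θ U₀ hU₀g
  have hplaqP : ∀ t, t < K - J → PlaqSmall ((fun (t : ℕ) => θ (J + (t + 1))) t)
      (Averaging.iter (fun k => blockAvg (P := F.P K) (j := k) ℰp) (K - (J + (t + 1))) (fun ℓ => expPoint (ζ ℓ) * U₀ ℓ)) :=
    hplaqP_of_histGood θ U₀ ζ hζg
  -- κ side: δC the boxed Pi-sup (px16 δ), ρκ the W-ρκ expression (✓p835991)
  have hδC0 : ∀ t B, 0 ≤ (fun (t : ℕ) (B : PBond (F.P J) 0) => if ht : t < K - J then ‖(fun ℓ' : PBond (F.P (J + (t + 1))) 0 =>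
        if (∃ ℓ'' : PBond (F.P (J + (t + 1))) 0, (∃ z : Site (F.P (J + (t + 1))) 0,
                (B14.Eq22Determines.blockIter (t + 1) z = (bondShift (F.sitesPerDir_eq (m := F.m) (K := J) (j := 0) (m' := F.m) (K' := J + (t + 1)) (j' := t + 1) (by omega)) B).src ∨ B14.Eq22Determines.blockIter (t + 1) z = (bondShift (F.sitesPerDir_eq (m := F.m) (K := J) (j := 0) (m' := F.m) (K' := J + (t + 1)) (j' := t + 1) (by omega)) B).tgt) ∧
                ∀ ν, (B10Eq27TorusAxialLog.rel z ℓ''.src ν).natAbs ≤ 2) ∧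
                (blockOf ℓ'.src = (blockOf ℓ''.src).unshift ℓ''.dir ∨ blockOf ℓ'.src = blockOf ℓ''.src ∨ blockOf ℓ'.src = (blockOf ℓ''.src).shift ℓ''.dir))
        then logVec (su2Quat (descendTo F ℰp (J + (t + 1)) K (by omega) (fun ℓ => expPoint (ζ ℓ) * U₀ ℓ : GaugeField (F.P K) 0 (Matrix.specialUnitaryGroup (Fin 2) ℂ)) ℓ' * (descendTo F ℰp (J + (t + 1)) K (by omega) U₀ ℓ')⁻¹)) else 0)‖ else 0) t B := fun t B => by
    dsimp only
    split_ifs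
    · exact norm_nonneg _
    · exact le_rfl
  have hδT := hδT_of_boxSup hJK U₀ ζ
  have hκrel := hκrel_of_textLetters U₀ ζ U₁ g g₀ hT3 hT3' hU₀ ρP (fun (t : ℕ) (B : PBond (F.P J) 0) => if ht : t < K - J then ‖(fun ℓ' : PBond (F.P (J + (t + 1))) 0 =>
        if (∃ ℓ'' : PBond (F.P (J + (t + 1))) 0, (∃ z : Site (F.P (J + (t + 1))) 0,
                (B14.Eq22Determines.blockIter (t + 1) z = (bondShift (F.sitesPerDir_eq (m := F.m) (K := J) (j := 0) (m' := F.m) (K' := J + (t + 1)) (j' := t + 1) (by omega)) B).src ∨ B14.Eq22Determines.blockIter (t + 1) z = (bondShift (F.sitesPerDir_eq (m := F.m) (K := J) (j := 0) (m' := F.m) (K' := J + (t + 1)) (j' := t + 1) (by omega)) B).tgt) ∧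
                ∀ ν, (B10Eq27TorusAxialLog.rel z ℓ''.src ν).natAbs ≤ 2) ∧
                (blockOf ℓ'.src = (blockOf ℓ''.src).unshift ℓ''.dir ∨ blockOf ℓ'.src = blockOf ℓ''.src ∨ blockOf ℓ'.src = (blockOf ℓ''.src).shift ℓ''.dir))
        then logVec (su2Quat (descendTo F ℰp (J + (t + 1)) K (by omega) (fun ℓ => expPoint (ζ ℓ) * U₀ ℓ : GaugeField (F.P K) 0 (Matrix.specialUnitaryGroup (Fin 2) ℂ)) ℓ' * (descendTo F ℰp (J + (t + 1)) K (by omega) U₀ ℓ')⁻¹)) else 0)‖ else 0) (fun (t : ℕ) => θ (J + (t + 1))) (fun (t : ℕ) => θ (J + (t + 1))) hρP0 hδC0 ha0 ha0 hplaq hplaqP hthrN hρT hδT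
  have hρκ := hρκ_of_columns hJK U₀ ζ θ ρP (fun (t : ℕ) => θ (J + (t + 1))) ha0 haα hP
  have hRK0 : ∀ t B, 0 ≤ (fun (t : ℕ) (B : PBond (F.P J) 0) => 3 * ((((((F.P K).d + 2) * (F.P K).L : ℕ) : ℝ) ^ 2 / 4) * (ρP t B + 2 * (fun (t : ℕ) => θ (J + (t + 1))) t * ((((((F.P K).d + 2) * (F.P K).L : ℕ) : ℝ) + 2) * (fun (t : ℕ) (B : PBond (F.P J) 0) => if ht : t < K - J then ‖(fun ℓ' : PBond (F.P (J + (t + 1))) 0 =>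
        if (∃ ℓ'' : PBond (F.P (J + (t + 1))) 0, (∃ z : Site (F.P (J + (t + 1))) 0,
                (B14.Eq22Determines.blockIter (t + 1) z = (bondShift (F.sitesPerDir_eq (m := F.m) (K := J) (j := 0) (m' := F.m) (K' := J + (t + 1)) (j' := t + 1) (by omega)) B).src ∨ B14.Eq22Determines.blockIter (t + 1) z = (bondShift (F.sitesPerDir_eq (m := F.m) (K := J) (j := 0) (m' := F.m) (K' := J + (t + 1)) (j' := t + 1) (by omega)) B).tgt) ∧
                ∀ ν, (B10Eq27TorusAxialLog.rel z ℓ''.src ν).natAbs ≤ 2) ∧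
                (blockOf ℓ'.src = (blockOf ℓ''.src).unshift ℓ''.dir ∨ blockOf ℓ'.src = blockOf ℓ''.src ∨ blockOf ℓ'.src = (blockOf ℓ''.src).shift ℓ''.dir))
        then logVec (su2Quat (descendTo F ℰp (J + (t + 1)) K (by omega) (fun ℓ => expPoint (ζ ℓ) * U₀ ℓ : GaugeField (F.P K) 0 (Matrix.specialUnitaryGroup (Fin 2) ℂ)) ℓ' * (descendTo F ℰp (J + (t + 1)) K (by omega) U₀ ℓ')⁻¹)) else 0)‖ else 0) t B)))) t B := fun t B =>
    mul_nonneg (by norm_num) (mul_nonneg (by positivity) (add_nonneg (hρP0 t B)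
      (mul_nonneg (mul_nonneg (by norm_num) (ha0 t)) (mul_nonneg (by positivity) (hδC0 t B)))))
  -- the two conjuncts by name
  refine ⟨_, hDisc_of_discRow hJK U₀ ζ wt lift U₁ g g₀ hwt hlift hT3 hT4 hT3' hT4' hU₀ hL2 (le_refl (1 / 4 : ℝ)) hArc hg1 hg1' hT6 hT5r hmate
      (fun (t : ℕ) (B : PBond (F.P J) 0) => 3 * ((((((F.P K).d + 2) * (F.P K).L : ℕ) : ℝ) ^ 2 / 4) * (ρP t B + 2 * (fun (t : ℕ) => θ (J + (t + 1))) t * ((((((F.P K).d + 2) * (F.P K).L : ℕ) : ℝ) + 2) * (fun (t : ℕ) (B : PBond (F.P J) 0) => if ht : t < K - J then ‖(fun ℓ' : PBond (F.P (J + (t + 1))) 0 =>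
        if (∃ ℓ'' : PBond (F.P (J + (t + 1))) 0, (∃ z : Site (F.P (J + (t + 1))) 0,
                (B14.Eq22Determines.blockIter (t + 1) z = (bondShift (F.sitesPerDir_eq (m := F.m) (K := J) (j := 0) (m' := F.m) (K' := J + (t + 1)) (j' := t + 1) (by omega)) B).src ∨ B14.Eq22Determines.blockIter (t + 1) z = (bondShift (F.sitesPerDir_eq (m := F.m) (K := J) (j := 0) (m' := F.m) (K' := J + (t + 1)) (j' := t + 1) (by omega)) B).tgt) ∧
                ∀ ν, (B10Eq27TorusAxialLog.rel z ℓ''.src ν).natAbs ≤ 2) ∧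
                (blockOf ℓ'.src = (blockOf ℓ''.src).unshift ℓ''.dir ∨ blockOf ℓ'.src = blockOf ℓ''.src ∨ blockOf ℓ'.src = (blockOf ℓ''.src).shift ℓ''.dir))
        then logVec (su2Quat (descendTo F ℰp (J + (t + 1)) K (by omega) (fun ℓ => expPoint (ζ ℓ) * U₀ ℓ : GaugeField (F.P K) 0 (Matrix.specialUnitaryGroup (Fin 2) ℂ)) ℓ' * (descendTo F ℰp (J + (t + 1)) K (by omega) U₀ ℓ')⁻¹)) else 0)‖ else 0) t B)))) ρt (fun (t : ℕ) => θ (J + (t + 1))) hRK0 hρt0 ha0 hplaq hthr hκrel hρ one_pos, ?_⟩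
  have hX := hX'_of_rColumn hJK U₀ ζ hmate θ (fun (t : ℕ) (B : PBond (F.P J) 0) => 3 * ((((((F.P K).d + 2) * (F.P K).L : ℕ) : ℝ) ^ 2 / 4) * (ρP t B + 2 * (fun (t : ℕ) => θ (J + (t + 1))) t * ((((((F.P K).d + 2) * (F.P K).L : ℕ) : ℝ) + 2) * (fun (t : ℕ) (B : PBond (F.P J) 0) => if ht : t < K - J then ‖(fun ℓ' : PBond (F.P (J + (t + 1))) 0 =>
        if (∃ ℓ'' : PBond (F.P (J + (t + 1))) 0, (∃ z : Site (F.P (J + (t + 1))) 0,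
                (B14.Eq22Determines.blockIter (t + 1) z = (bondShift (F.sitesPerDir_eq (m := F.m) (K := J) (j := 0) (m' := F.m) (K' := J + (t + 1)) (j' := t + 1) (by omega)) B).src ∨ B14.Eq22Determines.blockIter (t + 1) z = (bondShift (F.sitesPerDir_eq (m := F.m) (K := J) (j := 0) (m' := F.m) (K' := J + (t + 1)) (j' := t + 1) (by omega)) B).tgt) ∧
                ∀ ν, (B10Eq27TorusAxialLog.rel z ℓ''.src ν).natAbs ≤ 2) ∧
                (blockOf ℓ'.src = (blockOf ℓ''.src).unshift ℓ''.dir ∨ blockOf ℓ'.src = blockOf ℓ''.src ∨ blockOf ℓ'.src = (blockOf ℓ''.src).shift ℓ''.dir))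
        then logVec (su2Quat (descendTo F ℰp (J + (t + 1)) K (by omega) (fun ℓ => expPoint (ζ ℓ) * U₀ ℓ : GaugeField (F.P K) 0 (Matrix.specialUnitaryGroup (Fin 2) ℂ)) ℓ' * (descendTo F ℰp (J + (t + 1)) K (by omega) U₀ ℓ')⁻¹)) else 0)‖ else 0) t B)))) ρt (fun (t : ℕ) => θ (J + (t + 1))) ha0 haα one_pos
    (hR_of_columns U₀ ζ θ (fun (t : ℕ) (B : PBond (F.P J) 0) => 3 * ((((((F.P K).d + 2) * (F.P K).L : ℕ) : ℝ) ^ 2 / 4) * (ρP t B + 2 * (fun (t : ℕ) => θ (J + (t + 1))) t * ((((((F.P K).d + 2) * (F.P K).L : ℕ) : ℝ) + 2) * (fun (t : ℕ) (B : PBond (F.P J) 0) => if ht : t < K - J then ‖(fun ℓ' : PBond (F.P (J + (t + 1))) 0 =>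
        if (∃ ℓ'' : PBond (F.P (J + (t + 1))) 0, (∃ z : Site (F.P (J + (t + 1))) 0,
                (B14.Eq22Determines.blockIter (t + 1) z = (bondShift (F.sitesPerDir_eq (m := F.m) (K := J) (j := 0) (m' := F.m) (K' := J + (t + 1)) (j' := t + 1) (by omega)) B).src ∨ B14.Eq22Determines.blockIter (t + 1) z = (bondShift (F.sitesPerDir_eq (m := F.m) (K := J) (j := 0) (m' := F.m) (K' := J + (t + 1)) (j' := t + 1) (by omega)) B).tgt) ∧
                ∀ ν, (B10Eq27TorusAxialLog.rel z ℓ''.src ν).natAbs ≤ 2) ∧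
                (blockOf ℓ'.src = (blockOf ℓ''.src).unshift ℓ''.dir ∨ blockOf ℓ'.src = blockOf ℓ''.src ∨ blockOf ℓ'.src = (blockOf ℓ''.src).shift ℓ''.dir))
        then logVec (su2Quat (descendTo F ℰp (J + (t + 1)) K (by omega) (fun ℓ => expPoint (ζ ℓ) * U₀ ℓ : GaugeField (F.P K) 0 (Matrix.specialUnitaryGroup (Fin 2) ℂ)) ℓ' * (descendTo F ℰp (J + (t + 1)) K (by omega) U₀ ℓ')⁻¹)) else 0)‖ else 0) t B)))) ρt one_pos hρκ hρt)
  have eKc : (((((F.P K).d + 2) * (F.P K).L : ℕ) : ℝ)) = ((5 * F.L : ℕ) : ℝ) := rfl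
  have eCadj : ((2 * (F.P J).d * 7 ^ (F.P J).d : ℕ) : ℝ) = ((2 * 3 * 7 ^ 3 : ℕ) : ℝ) := rfl
  rw [eKc, eCadj] at hX
  exact hX.trans (le_of_eq (by ring))

end Summit.QuantumFields.YangMills.Theorems.FluctuationComparisonRegPrIntLS2BetaDiscBudgetOfColumns
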